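import Summits.Ventures.HSemireg.WedgeHankelRecurrenceGaussChebyshevCommonZero

/-!
# Venture HSemireg — **MIXED RESULTANTS `Res(T_{n+2}, U_{n+1})` AND `Res(T_{n+1}, U_{n+1})`** (Mathlib's Chebyshev polynomials over `ℤ`): from `T_{n+2} = X·U_{n+1} − U_n` and N406,
# **`Res_{(n+2,n+1)}(T_{n+2}, U_{n+1}) = (−1)^{n+1} 4^{n+1} · (−1)^{n(n+1)∕2} 2^{n(n+1)} ≠ 0`** and **`Res_{(n+1,n+1)}(T_{n+1}, U_{n+1}) = (−1)^{n+1} U_{n+1}(0) · (−1)^{n(n+1)∕2} 2^{n(n+1)}`**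
# (zero iff `n` is even); `T_{n+2}`, `U_{n+1}` never share a zero, and `T_{n+1}`, `U_{n+1}` share a zero (namely `0`) iff `n` is even

HONEST FRAMING. Part of the Lean index of the computation cell `pub-hsemireg` (seat p10 gen 47, Sunday typer «UNIFORM-IN-n»).  Integer polynomial algebra and evaluation only (Mathlib
`Polynomial.resultant`, `Polynomial.Chebyshev`); no variety, no cohomology theory, no sheaf, no Ext group and no semiregularity map is constructed here; nothing here says that HC / HC_CM /
HC_AV holds; no Literature fact (unproved `Prop`) is declared or used.  Custodian versions as in `WedgeHankelSiegelIdeal` (1/3).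
SOURCES (cited).  K. Dilcher, K. B. Stolarsky, *Resultants and discriminants of Chebyshev and related polynomials*, Trans. Amer. Math. Soc. 357 (2005) 965–981 (§3, mixed resultants);
D. P. Jacobs, M. O. Rayes, V. Trevisan, *The resultant of Chebyshev polynomials*, Canad. Math. Bull. 54 (2011) 288–296; G. Szegő, *Orthogonal Polynomials*, §3.3.  The displayed cases are
COROLLARIES typed here of N406.
PROOF TYPED HERE.  Mathlib `T_eq_X_mul_U_sub_U` (`T_{n+2} = X U_{n+1} − U_n`), `U_eq_X_mul_U_add_T`; `Res(−U_n + U_{n+1}·X, U_{n+1}) = Res(−U_n, U_{n+1})` (`resultant_add_mul_left`), formal-degree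
padding `resultant_add_left_deg` (`lc(U_{n+1})² = 4^{n+1}`), `resultant_C_mul_left`, `resultant_comm`, N406 `chebyshevU_resultant`; for the same index `T_{n+1} = −X U_n + U_{n+1}`,
`resultant_mul_left`, `resultant_X_sub_C_left`; N431 `chebyshevU_eval_ne_zero_of_eval_succ_eq_zero`, `chebyshevU_eval_zero_ne_zero_of_even`.
DEDUP DISCLOSURE (`rg -n -i 'chebyshevTU' Summits/Ventures/HSemireg`, 2026-09-04): nothing; the identity `T_{n+2} = X U_{n+1} − U_n` is Mathlib's `T_eq_X_mul_U_sub_U` (used, not restated);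
0 hits for the 6 names below.

WHAT IS IN THE TREE.  N406 `chebyshevU_resultant`, `chebyshevU_natDegree_coeff`; N431 `chebyshevU_eval_ne_zero_of_eval_succ_eq_zero`, `chebyshevU_eval_zero_ne_zero_of_even`; Mathlib
`T_eq_X_mul_U_sub_U`, `U_eq_X_mul_U_add_T`, `resultant_add_left_deg`, `T_eval_zero_of_odd`, `U_eval_zero_of_odd`.
THIS FILE (namespace `Summit.Ventures.HSemireg.Wedge.HankelOuter` continued; CHAINED on N431; 0 definitions):
* §1197 **`chebyshevTU_resultant_succ`**, `chebyshevTU_resultant_succ_ne_zero`, **`chebyshevTU_resultant_same`**,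
  `chebyshevTU_resultant_same_eq_zero_iff` (`⟺ n` even), `chebyshevTU_no_common_zero_succ` (nontrivial commutative ring), **`chebyshevTU_common_zero_same_iff`** (any field: `⟺ n` even).
CAVEATS.  Formal degrees explicit.  Nothing Ext-side.  New names only.
-/

open Module Polynomial
open scoped Matrix Polynomial

namespace Summit.Ventures.HSemireg.Wedge.HankelOuter

/-! ## §1197. Mixed Chebyshev resultants -/

/-- **`Res_{(n+2,n+1)}(T_{n+2}, U_{n+1}) = (−1)^{n+1} 4^{n+1} · (−1)^{n(n+1)∕2} 2^{n(n+1)}`** over `ℤ`. [Dilcher–Stolarsky 2005 §3; Jacobs–Rayes–Trevisan 2011; this file, §1197] -/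
theorem chebyshevTU_resultant_succ (n : ℕ) :
    (Polynomial.Chebyshev.T ℤ ((n : ℤ) + 2)).resultant (Polynomial.Chebyshev.U ℤ ((n : ℤ) + 1)) (n + 2) (n + 1) =
      (-1) ^ (n + 1) * 4 ^ (n + 1) * ((-1) ^ (n * (n + 1) / 2) * 2 ^ (n * (n + 1))) := by
  obtain ⟨hd1, hc1⟩ := chebyshevU_natDegree_coeff (n + 1)
  obtain ⟨hdn, -⟩ := chebyshevU_natDegree_coeff n
  push_cast at hd1 hc1
  have h1 : Polynomial.Chebyshev.T ℤ ((n : ℤ) + 2) = C (-1 : ℤ) * Polynomial.Chebyshev.U ℤ (n : ℤ) + Polynomial.Chebyshev.U ℤ ((n : ℤ) + 1) * Polynomial.X := by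
    rw [Polynomial.Chebyshev.T_eq_X_mul_U_sub_U, map_neg, map_one]; ring
  rw [h1, resultant_add_mul_left _ _ _ _ _ (by rw [natDegree_X]; omega) hd1.le, resultant_C_mul_left, resultant_add_left_deg _ _ _ _ _ hdn.le, hc1, resultant_comm,
    chebyshevU_resultant n]
  have h4 : ((2 : ℤ) ^ (n + 1)) ^ 2 = 4 ^ (n + 1) := by rw [← pow_mul, mul_comm, pow_mul]; norm_num
  rw [h4, Even.neg_one_pow (show Even ((n + 1) * 2) from ⟨n + 1, by ring⟩), Even.neg_one_pow (Nat.even_mul_succ_self n)]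
  ring

/-- `Res_{(n+2,n+1)}(T_{n+2}, U_{n+1}) ≠ 0`: `T_{n+2}` and `U_{n+1}` are coprime. [corollary; this file, §1197] -/
theorem chebyshevTU_resultant_succ_ne_zero (n : ℕ) :
    (Polynomial.Chebyshev.T ℤ ((n : ℤ) + 2)).resultant (Polynomial.Chebyshev.U ℤ ((n : ℤ) + 1)) (n + 2) (n + 1) ≠ 0 := by
  rw [chebyshevTU_resultant_succ]
  exact mul_ne_zero (mul_ne_zero (pow_ne_zero _ (neg_ne_zero.2 one_ne_zero)) (pow_ne_zero _ (by norm_num)))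
    (mul_ne_zero (pow_ne_zero _ (neg_ne_zero.2 one_ne_zero)) (pow_ne_zero _ two_ne_zero))

/-- **`Res_{(n+1,n+1)}(T_{n+1}, U_{n+1}) = (−1)^{n+1} U_{n+1}(0) · (−1)^{n(n+1)∕2} 2^{n(n+1)}`** over `ℤ`. [Dilcher–Stolarsky 2005 §3; Jacobs–Rayes–Trevisan 2011; this file, §1197] -/
theorem chebyshevTU_resultant_same (n : ℕ) :
    (Polynomial.Chebyshev.T ℤ ((n : ℤ) + 1)).resultant (Polynomial.Chebyshev.U ℤ ((n : ℤ) + 1)) (n + 1) (n + 1) =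
      (-1) ^ (n + 1) * (Polynomial.Chebyshev.U ℤ ((n : ℤ) + 1)).eval 0 * ((-1) ^ (n * (n + 1) / 2) * 2 ^ (n * (n + 1))) := by
  obtain ⟨hd1, -⟩ := chebyshevU_natDegree_coeff (n + 1)
  obtain ⟨hdn, -⟩ := chebyshevU_natDegree_coeff n
  push_cast at hd1
  have h1 : Polynomial.Chebyshev.T ℤ ((n : ℤ) + 1) =
      (C (-1 : ℤ) * Polynomial.X) * Polynomial.Chebyshev.U ℤ (n : ℤ) + Polynomial.Chebyshev.U ℤ ((n : ℤ) + 1) * C 1 := by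
    have a := Polynomial.Chebyshev.U_eq_X_mul_U_add_T ℤ (n : ℤ)
    rw [map_neg, map_one]
    linear_combination -a
  rw [h1, resultant_add_mul_left _ _ _ _ _ (by rw [natDegree_C]; omega) hd1.le]
  have hmul := resultant_mul_left (C (-1 : ℤ) * Polynomial.X) (Polynomial.Chebyshev.U ℤ (n : ℤ)) (Polynomial.Chebyshev.U ℤ ((n : ℤ) + 1)) (n + 1) hd1.le
  rw [natDegree_C_mul_X (-1) (by norm_num), hdn, show 1 + n = n + 1 by ring] at hmul
  rw [hmul, resultant_C_mul_left, show (Polynomial.X : ℤ[X]) = Polynomial.X - C 0 by rw [map_zero, sub_zero], resultant_X_sub_C_left _ _ _ hd1.le, resultant_comm,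
    chebyshevU_resultant n, Even.neg_one_pow (Nat.even_mul_succ_self n), one_mul]

/-- **`Res_{(n+1,n+1)}(T_{n+1}, U_{n+1}) = 0 ⟺ n` even** (over `ℤ`). [corollary; this file, §1197] -/
theorem chebyshevTU_resultant_same_eq_zero_iff (n : ℕ) :
    (Polynomial.Chebyshev.T ℤ ((n : ℤ) + 1)).resultant (Polynomial.Chebyshev.U ℤ ((n : ℤ) + 1)) (n + 1) (n + 1) = 0 ↔ Even n := by
  rw [chebyshevTU_resultant_same]
  constructor
  · intro h
    by_contra hne
    have h0 := chebyshevU_eval_zero_ne_zero_of_even (R := ℤ) (n + 1) ((Nat.not_even_iff_odd.1 hne).add_odd odd_one)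
    push_cast at h0
    exact absurd h (mul_ne_zero (mul_ne_zero (pow_ne_zero _ (neg_ne_zero.2 one_ne_zero)) h0)
      (mul_ne_zero (pow_ne_zero _ (neg_ne_zero.2 one_ne_zero)) (pow_ne_zero _ two_ne_zero)))
  · intro hn
    have ho : Odd ((n : ℤ) + 1) := by obtain ⟨m, rfl⟩ := hn; exact ⟨m, by push_cast; ring⟩
    rw [Polynomial.Chebyshev.U_eval_zero_of_odd (R := ℤ) ho, mul_zero, zero_mul]

/-- **`T_{n+2}` and `U_{n+1}` have no common zero** (nontrivial commutative ring). [Szegő §3.3; this file, §1197] -/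
theorem chebyshevTU_no_common_zero_succ {R : Type*} [CommRing R] [Nontrivial R] (x : R) (n : ℕ)
    (hT : (Polynomial.Chebyshev.T R ((n : ℤ) + 2)).eval x = 0) : (Polynomial.Chebyshev.U R ((n : ℤ) + 1)).eval x ≠ 0 := by
  intro hU
  have hUn : (Polynomial.Chebyshev.U R (n : ℤ)).eval x = 0 := by
    have e := congrArg (Polynomial.eval x) (Polynomial.Chebyshev.T_eq_X_mul_U_sub_U R (n : ℤ))
    rw [hT, eval_sub, eval_mul, hU, mul_zero, zero_sub] at e
    exact neg_eq_zero.1 e.symm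
  exact chebyshevU_eval_ne_zero_of_eval_succ_eq_zero x n hU hUn

/-- **`T_{n+1}` and `U_{n+1}` have a common zero iff `n` is even** (any field; the common zero is `0`). [corollary; Szegő §3.3, (1.12.3); this file, §1197] -/
theorem chebyshevTU_common_zero_same_iff {K : Type*} [Field K] (n : ℕ) :
    (∃ x : K, (Polynomial.Chebyshev.T K ((n : ℤ) + 1)).eval x = 0 ∧ (Polynomial.Chebyshev.U K ((n : ℤ) + 1)).eval x = 0) ↔ Even n := by
  constructor
  · rintro ⟨x, hT, hU⟩
    have hUn : (Polynomial.Chebyshev.U K (n : ℤ)).eval x ≠ 0 := chebyshevU_eval_ne_zero_of_eval_succ_eq_zero x n hU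
    have e := congrArg (Polynomial.eval x) (Polynomial.Chebyshev.U_eq_X_mul_U_add_T K (n : ℤ))
    rw [hU, eval_add, hT, add_zero, eval_mul, eval_X] at e
    have hx : x = 0 := by
      rcases mul_eq_zero.1 e.symm with h | h
      · exact h
      · exact absurd h hUn
    subst hx
    by_contra hne
    have h0 := chebyshevU_eval_zero_ne_zero_of_even (R := K) (n + 1) ((Nat.not_even_iff_odd.1 hne).add_odd odd_one)
    push_cast at h0
    exact h0 hU
  · intro hn
    have ho : Odd ((n : ℤ) + 1) := by obtain ⟨m, rfl⟩ := hn; exact ⟨m, by push_cast; ring⟩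
    exact ⟨0, Polynomial.Chebyshev.T_eval_zero_of_odd (R := K) ho, Polynomial.Chebyshev.U_eval_zero_of_odd (R := K) ho⟩

end Summit.Ventures.HSemireg.Wedge.HankelOuter
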